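import Summits.HodgeConjecture.CorCM.CyclotomicTwoPowerPIntegers
import HarnessLib

/-!
# A primitive `2^{a+1}`-th root of unity is not a norm from `ℤ[ζ_{2^{a+1}p}]` to the fixed ring of
# `ζ ↦ ζ^e` (`e ≡ 1 (mod 2^{a+1})`, `e ≡ −1 (mod p)`): the descent through a RESIDUE FIELD of `p`

COR-CM (cell `pub-hodgecm2`), binder seat b04 (gen 26), count-neutral claim CYCLIC-SEMIDIRECT-RESIDUE, part IIIb♯ — the
residue-field form of `CorCM/CyclotomicTwoPowerPNormDescent` (which is the case `e = 2p − 1`, `k = 𝔽_p`, available only when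
`2^{a+1} ∣ p − 1`).  Mathlib (+ `CorCM/CyclotomicTwoPowerPIntegers`, `CorCM/CyclotomicFourPIntegers.ringHom_ext`) only.
KERNEL ONLY: theorems; no definition, no named fact, no `sorry`.

SETTING.  `p` an odd prime, `Λ = ℤ[X]/(Φ_{2^{a+1}p})` with generator `μ`, `g = 1 + μ^{2^a}`, `η = −μ^{2^a}`;
an exponent `e` with `e ≡ 1 (mod 2^{a+1})` and `e ≡ −1 (mod p)` (so `e ≡ 2p − 1 (mod 2p)` and `gcd(e, 2^{a+1}p) = 1`), and
`ρ̃ : μ ↦ μ^e` (fixes `μ_{2^{a+1}}`, inverts `μ_p`); the reduction `π_R : Λ → R = 𝔽_p[X]/(X^{2^a}+1)` of part IIIa (kernel `gΛ`,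
`R` reduced); and a RESIDUE MAP `π : Λ → k`, `μ ↦ s`, into ANY field `k` over `𝔽_p` containing an `s` with `s^{2^a} = −1`
(a primitive `2^{a+1}`-th root of unity) — e.g. `k = 𝔽_{p^f}` with `2^{a+1} ∣ p^f − 1`.

THEOREM (`descentK`).  If NO `x ∈ k` has `x^{2^{a+1}} = −1` (for `k = 𝔽_{p^f}`: `2^{a+2} ∤ p^f − 1`), then no `Z ∈ Λ`, `n ≥ 1`,
`j` odd, `U ∈ Λ` with `π(U)` a non-zero square satisfy `Z ρ̃(Z) = n² μ^{pj} U`.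
PROOF.  `π ∘ ρ̃ = π` and `π_R ∘ ρ̃ = π_R` (`e ≡ 1 (mod 2^{a+1})`).  If `p ∤ n`: `x = π(Z)/(n̄ c)` has `x² = π(μ)^{pj}`, so
`x^{2^{a+1}} = (s^{2^a})^{pj} = −1` — excluded.  If `p ∣ n`: `π_R(Z)² = 0`, `R` reduced, so `Z = g Z₁`; with `ρ̃(g) = g ε₂`
(`ε₂ (−η) = 1`) and `p = g^{p−1} ε` peel `p − 1` factors of `g` and recurse on `n/p` (`π(ε) = (p−1)! ≠ 0` by Wilson).

* §1 the exponent: `odd_exp`, `coprime_exp`, `exists_exp_mul_eq`, `root_pow_exp_pow` (`(μ^e)^{2^a} = (μ^{2p−1})^{2^a}`).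
* §2 the residue map: `eval₂_cyclotomic_of_pow_eq`, `liftK_rhoE_eq`, `liftR_rhoE_eq`, `liftK_root_pow_pow`, `liftK_eta`,
  `liftK_eps_ne_zero`.
* §3 `peelE`, `peelE_iter`.
* §4 **`descentK`**.

## References

* [FeinGordonSmith1971] B. Fein, B. Gordon, J. H. Smith, J. Number Theory 3 (1971), 310–315.
* [Washington1997] L. C. Washington, *Introduction to Cyclotomic Fields*, Prop. 2.8, Thm. 2.13.
-/

noncomputable section

open Polynomial

namespace Summit.HodgeConjecture.CorCM.CyclotomicTwoPowerP.Residue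

variable {p a e : ℕ}

/-! ## §1 The exponent `e ≡ 1 (mod 2^{a+1})`, `e ≡ −1 (mod p)` -/

/-- `e` is odd. [folklore] -/
theorem odd_exp (he : e % 2 ^ (a + 1) = 1) : Odd e := by
  rw [Nat.odd_iff]
  have h := Nat.mod_mod_of_dvd e (dvd_pow_self 2 (Nat.succ_ne_zero a))
  rw [he] at h
  omega

/-- `gcd(e, 2^{a+1}p) = 1`. [folklore] -/
theorem coprime_exp (hp : p.Prime) (he : e % 2 ^ (a + 1) = 1) (hpe : (e + 1) % p = 0) :
    e.Coprime (2 ^ (a + 1) * p) := by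
  refine Nat.Coprime.mul_right (Nat.Coprime.pow_right _ (Nat.coprime_two_right.2 (odd_exp he))) ?_
  refine Nat.Coprime.symm ((Nat.Prime.coprime_iff_not_dvd hp).2 fun h => ?_)
  have h1 : p ∣ e + 1 := Nat.dvd_of_mod_eq_zero hpe
  have : p ∣ 1 := (Nat.dvd_add_right h).1 h1
  exact hp.one_lt.ne' (Nat.dvd_one.1 this)

/-- `e = 2pm − 1` with `m ≥ 1`: `e + 1 = 2 p m`. [folklore] -/
theorem exists_exp_mul_eq (hp : p.Prime) (hp2 : p ≠ 2) (he : e % 2 ^ (a + 1) = 1) (hpe : (e + 1) % p = 0) :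
    ∃ m : ℕ, 0 < m ∧ e + 1 = 2 * p * m := by
  obtain ⟨q, hq⟩ := Nat.dvd_of_mod_eq_zero hpe
  have hodd := odd_exp he
  have hpodd : Odd p := hp.odd_of_ne_two hp2
  have hqev : Even q := by
    have hev : Even (e + 1) := hodd.add_one
    rw [hq, Nat.even_mul] at hev
    rcases hev with h | h
    · exact absurd h (Nat.not_even_iff_odd.2 hpodd)
    · exact h
  obtain ⟨m, rfl⟩ := hqev
  refine ⟨m, ?_, by rw [hq]; ring⟩
  rcases Nat.eq_zero_or_pos m with rfl | h
  · simp at hq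
  · exact h

/-- **`(μ^e)^{2^a} = (μ^{2p−1})^{2^a}`** (`e ≡ 2p − 1 (mod 2p)`, `μ^{2^{a+1}p} = 1`). [folklore] -/
theorem root_pow_exp_pow (hp : p.Prime) (hp2 : p ≠ 2) (he : e % 2 ^ (a + 1) = 1) (hpe : (e + 1) % p = 0) :
    (AdjoinRoot.root (cyclotomic (2 ^ (a + 1) * p) ℤ) ^ e) ^ 2 ^ a =
      (AdjoinRoot.root (cyclotomic (2 ^ (a + 1) * p) ℤ) ^ (2 * p - 1)) ^ 2 ^ a := by
  obtain ⟨m, hm, hem⟩ := exists_exp_mul_eq hp hp2 he hpe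
  have hμ := isPrimitiveRoot_root (a := a) hp.pos
  have h2 := hp.two_le
  have harith : e * 2 ^ a = (2 * p - 1) * 2 ^ a + (2 ^ (a + 1) * p) * (m - 1) := by
    have : e = 2 * p * m - 1 := by omega
    subst this
    rcases m with _ | m
    · omega
    · rw [Nat.add_sub_cancel, pow_succ]
      zify [show 1 ≤ 2 * p * (m + 1) by nlinarith, show 1 ≤ 2 * p by omega]
      ring
  rw [← pow_mul, ← pow_mul, harith, pow_add (AdjoinRoot.root (cyclotomic (2 ^ (a + 1) * p) ℤ)),
    pow_mul (AdjoinRoot.root (cyclotomic (2 ^ (a + 1) * p) ℤ)) (2 ^ (a + 1) * p), hμ.pow_eq_one, one_pow, mul_one]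

/-! ## §2 The residue map `π : Λ → k`, `μ ↦ s` (`s^{2^a} = −1`), and `ρ̃ : μ ↦ μ^e` -/

section Residue

variable {k : Type*} [Field k] [Algebra (ZMod p) k]

/-- `Φ_{2^{a+1}p}(s) = 0` in a field `k ⊇ 𝔽_p` when `s^{2^a} = −1` (`Φ_{2^{a+1}p} ≡ (X^{2^a}+1)^{p−1} (mod p)`).
[cite: Washington1997, Thm. 2.13] -/
theorem eval₂_cyclotomic_of_pow_eq (hp : p.Prime) (hp2 : p ≠ 2) {s : k} (hs : s ^ 2 ^ a = -1) :
    (cyclotomic (2 ^ (a + 1) * p) ℤ).eval₂ (Int.castRingHom k) s = 0 := by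
  have hc : Int.castRingHom k = (algebraMap (ZMod p) k).comp (Int.castRingHom (ZMod p)) := Subsingleton.elim _ _
  rw [hc, ← eval₂_map, map_cyclotomic_eq hp hp2, eval₂_pow, eval₂_add, eval₂_X_pow, eval₂_one, hs, neg_add_cancel,
    zero_pow]
  have := hp.two_le; omega

/-- **`π ∘ ρ̃ = π`**: `s^e = s` because `s^{2^{a+1}} = 1` and `e ≡ 1 (mod 2^{a+1})`. [folklore] -/
theorem liftK_rhoE_eq (hp : p.Prime) (hp2 : p ≠ 2) (he : e % 2 ^ (a + 1) = 1) (hpe : (e + 1) % p = 0) {s : k}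
    (hs : s ^ 2 ^ a = -1) (Z : AdjoinRoot (cyclotomic (2 ^ (a + 1) * p) ℤ)) :
    AdjoinRoot.lift (Int.castRingHom k) s (eval₂_cyclotomic_of_pow_eq hp hp2 hs)
        (AdjoinRoot.lift (algebraMap ℤ _) (AdjoinRoot.root (cyclotomic (2 ^ (a + 1) * p) ℤ) ^ e)
          (eval₂_root_pow_cyclotomic hp.pos (coprime_exp hp he hpe)) Z) =
      AdjoinRoot.lift (Int.castRingHom k) s (eval₂_cyclotomic_of_pow_eq hp hp2 hs) Z := by
  have hs2 : s ^ 2 ^ (a + 1) = 1 := by rw [pow_succ, pow_mul, hs, neg_one_sq]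
  have hdm := Nat.div_add_mod e (2 ^ (a + 1))
  rw [he] at hdm
  have key := CyclotomicFourP.ringHom_ext (T := k)
    (φ₁ := (AdjoinRoot.lift (Int.castRingHom k) s (eval₂_cyclotomic_of_pow_eq hp hp2 hs)).comp
      (AdjoinRoot.lift (algebraMap ℤ _) (AdjoinRoot.root (cyclotomic (2 ^ (a + 1) * p) ℤ) ^ e)
        (eval₂_root_pow_cyclotomic hp.pos (coprime_exp hp he hpe))))
    (φ₂ := AdjoinRoot.lift (Int.castRingHom k) s (eval₂_cyclotomic_of_pow_eq hp hp2 hs)) (by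
      rw [RingHom.comp_apply, AdjoinRoot.lift_root, map_pow, AdjoinRoot.lift_root, ← hdm, pow_succ, pow_mul, hs2,
        one_pow, one_mul])
  exact DFunLike.congr_fun key Z

/-- **`π_R ∘ ρ̃ = π_R`** on `R = 𝔽_p[X]/(X^{2^a}+1)`: `r^e = r` because `r^{2^{a+1}} = 1`. [folklore] -/
theorem liftR_rhoE_eq (hp : p.Prime) (hp2 : p ≠ 2) (he : e % 2 ^ (a + 1) = 1) (hpe : (e + 1) % p = 0)
    (Z : AdjoinRoot (cyclotomic (2 ^ (a + 1) * p) ℤ)) :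
    AdjoinRoot.lift (Int.castRingHom _) (AdjoinRoot.root (X ^ 2 ^ a + 1 : (ZMod p)[X])) (eval₂_cyclotomic_R hp hp2)
        (AdjoinRoot.lift (algebraMap ℤ _) (AdjoinRoot.root (cyclotomic (2 ^ (a + 1) * p) ℤ) ^ e)
          (eval₂_root_pow_cyclotomic hp.pos (coprime_exp hp he hpe)) Z) =
      AdjoinRoot.lift (Int.castRingHom _) (AdjoinRoot.root (X ^ 2 ^ a + 1 : (ZMod p)[X])) (eval₂_cyclotomic_R hp hp2) Z := by
  have hdm := Nat.div_add_mod e (2 ^ (a + 1))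
  rw [he] at hdm
  have key := CyclotomicFourP.ringHom_ext (T := AdjoinRoot (X ^ 2 ^ a + 1 : (ZMod p)[X]))
    (φ₁ := (AdjoinRoot.lift (Int.castRingHom _) (AdjoinRoot.root (X ^ 2 ^ a + 1 : (ZMod p)[X]))
      (eval₂_cyclotomic_R hp hp2)).comp
      (AdjoinRoot.lift (algebraMap ℤ _) (AdjoinRoot.root (cyclotomic (2 ^ (a + 1) * p) ℤ) ^ e)
        (eval₂_root_pow_cyclotomic hp.pos (coprime_exp hp he hpe))))
    (φ₂ := AdjoinRoot.lift (Int.castRingHom _) (AdjoinRoot.root (X ^ 2 ^ a + 1 : (ZMod p)[X]))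
      (eval₂_cyclotomic_R hp hp2)) (by
      rw [RingHom.comp_apply, AdjoinRoot.lift_root, map_pow, AdjoinRoot.lift_root, ← hdm, pow_succ, pow_mul,
        rootR_pow, one_pow, one_mul])
  exact DFunLike.congr_fun key Z

/-- `π(μ^{pj})^{2^a} = −1` for `j` odd: `(s^{pj})^{2^a} = (s^{2^a})^{pj} = (−1)^{pj}`, `pj` odd. [folklore] -/
theorem liftK_root_pow_pow (hp : p.Prime) (hp2 : p ≠ 2) {s : k} (hs : s ^ 2 ^ a = -1) {j : ℕ} (hj : Odd j) :
    (AdjoinRoot.lift (Int.castRingHom k) s (eval₂_cyclotomic_of_pow_eq hp hp2 hs)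
      (AdjoinRoot.root (cyclotomic (2 ^ (a + 1) * p) ℤ) ^ (p * j))) ^ 2 ^ a = -1 := by
  rw [map_pow, AdjoinRoot.lift_root, ← pow_mul, mul_comm, pow_mul, hs]
  exact ((hp.odd_of_ne_two hp2).mul hj).neg_one_pow

/-- `π(η) = 1` for `η = −μ^{2^a}`. [folklore] -/
theorem liftK_eta (hp : p.Prime) (hp2 : p ≠ 2) {s : k} (hs : s ^ 2 ^ a = -1) :
    AdjoinRoot.lift (Int.castRingHom k) s (eval₂_cyclotomic_of_pow_eq hp hp2 hs)
      (-(AdjoinRoot.root (cyclotomic (2 ^ (a + 1) * p) ℤ)) ^ 2 ^ a) = 1 := by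
  rw [map_neg, map_pow, AdjoinRoot.lift_root, hs, neg_neg]

/-- **`π(ε) = (p−1)! ≠ 0`** in `k` (Wilson). [folklore] -/
theorem liftK_eps_ne_zero (hp : p.Prime) (hp2 : p ≠ 2) {s : k} (hs : s ^ 2 ^ a = -1) :
    AdjoinRoot.lift (Int.castRingHom k) s (eval₂_cyclotomic_of_pow_eq hp hp2 hs)
      (∏ j ∈ Finset.range (p - 1), ∑ m ∈ Finset.range (j + 1),
        (-(AdjoinRoot.root (cyclotomic (2 ^ (a + 1) * p) ℤ)) ^ 2 ^ a) ^ m) ≠ 0 := by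
  haveI : Fact p.Prime := ⟨hp⟩
  rw [map_prod]
  have hfac : ∀ j : ℕ, AdjoinRoot.lift (Int.castRingHom k) s (eval₂_cyclotomic_of_pow_eq hp hp2 hs)
      (∑ m ∈ Finset.range (j + 1), (-(AdjoinRoot.root (cyclotomic (2 ^ (a + 1) * p) ℤ)) ^ 2 ^ a) ^ m) =
        ((j + 1 : ℕ) : k) := fun j => by
    rw [map_sum]
    simp_rw [map_pow, liftK_eta hp hp2 hs, one_pow]
    simp
  simp_rw [hfac]
  rw [← Nat.cast_prod, Finset.prod_range_add_one_eq_factorial, ← map_natCast (algebraMap (ZMod p) k),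
    ZMod.wilsons_lemma, map_neg, map_one]
  exact neg_ne_zero.2 one_ne_zero

/-! ## §3 One `g`-adic step -/

/-- **Peeling one factor of `g = 1 + μ^{2^a}`** (exponent `e`). [cite: Washington1997, Prop. 2.8] -/
theorem peelE (hp : p.Prime) (hp2 : p ≠ 2) (he : e % 2 ^ (a + 1) = 1) (hpe : (e + 1) % p = 0) (n : ℕ)
    (Z V : AdjoinRoot (cyclotomic (2 ^ (a + 1) * p) ℤ))
    (hZ : Z * AdjoinRoot.lift (algebraMap ℤ _) (AdjoinRoot.root (cyclotomic (2 ^ (a + 1) * p) ℤ) ^ e)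
      (eval₂_root_pow_cyclotomic hp.pos (coprime_exp hp he hpe)) Z =
      (1 + AdjoinRoot.root (cyclotomic (2 ^ (a + 1) * p) ℤ) ^ 2 ^ a) ^ (2 * (n + 1)) * V) :
    ∃ Z₁ : AdjoinRoot (cyclotomic (2 ^ (a + 1) * p) ℤ),
      Z₁ * AdjoinRoot.lift (algebraMap ℤ _) (AdjoinRoot.root (cyclotomic (2 ^ (a + 1) * p) ℤ) ^ e)
        (eval₂_root_pow_cyclotomic hp.pos (coprime_exp hp he hpe)) Z₁ =
      (1 + AdjoinRoot.root (cyclotomic (2 ^ (a + 1) * p) ℤ) ^ 2 ^ a) ^ (2 * n) *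
        ((-(-(AdjoinRoot.root (cyclotomic (2 ^ (a + 1) * p) ℤ)) ^ 2 ^ a)) * V) := by
  haveI := isDomain (a := a) hp.pos
  set μ := AdjoinRoot.root (cyclotomic (2 ^ (a + 1) * p) ℤ) with hμ_def
  set ρ := AdjoinRoot.lift (algebraMap ℤ _) (μ ^ e)
    (eval₂_root_pow_cyclotomic hp.pos (coprime_exp hp he hpe)) with hρ_def
  set πR := AdjoinRoot.lift (Int.castRingHom _) (AdjoinRoot.root (X ^ 2 ^ a + 1 : (ZMod p)[X]))
    (eval₂_cyclotomic_R (a := a) hp hp2) with hπR_def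
  -- `π_R(Z)² = 0`, hence `π_R(Z) = 0`
  have hvan : πR Z = 0 := by
    have h := congrArg πR hZ
    rw [map_mul, hπR_def, liftR_rhoE_eq hp hp2 he hpe, map_mul, map_pow, liftR_one_add_root_pow hp hp2,
      zero_pow (by omega), zero_mul] at h
    exact eq_zero_of_sq_eq_zero_R hp hp2 _ (by rw [pow_two]; exact h)
  obtain ⟨Z₁, rfl⟩ := exists_eq_mul_of_liftR_eq_zero hp hp2 Z hvan
  refine ⟨Z₁, ?_⟩
  obtain ⟨hρg, hinv⟩ := one_add_root_pow_eq (a := a) hp hp2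
  have hρμ : ρ (1 + μ ^ 2 ^ a) = 1 + (μ ^ (2 * p - 1)) ^ 2 ^ a := by
    rw [map_add, map_one, map_pow, hρ_def, AdjoinRoot.lift_root, hμ_def, root_pow_exp_pow hp hp2 he hpe]
  rw [map_mul, hρμ, hρg] at hZ
  have hg := one_add_root_pow_ne_zero (a := a) hp hp2
  have h2 : (1 + μ ^ 2 ^ a) ^ 2 * ((∑ m ∈ Finset.range (p - 1), (-μ ^ 2 ^ a) ^ m) * (Z₁ * ρ Z₁)) =
      (1 + μ ^ 2 ^ a) ^ 2 * ((1 + μ ^ 2 ^ a) ^ (2 * n) * V) := by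
    have e2 : (1 + μ ^ 2 ^ a) ^ (2 * (n + 1)) = (1 + μ ^ 2 ^ a) ^ 2 * (1 + μ ^ 2 ^ a) ^ (2 * n) := by
      rw [← pow_add]; congr 1; ring
    rw [e2] at hZ
    linear_combination hZ
  have h3 := mul_left_cancel₀ (pow_ne_zero 2 hg) h2
  have h4 := congrArg (fun x => -(-μ ^ 2 ^ a) * x) h3
  rw [← mul_assoc, mul_comm (-(-μ ^ 2 ^ a)), hinv, one_mul] at h4
  rw [h4]
  ring

/-- **Iterated peeling** (exponent `e`). [cite: Washington1997, Prop. 2.8] -/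
theorem peelE_iter (hp : p.Prime) (hp2 : p ≠ 2) (he : e % 2 ^ (a + 1) = 1) (hpe : (e + 1) % p = 0) :
    ∀ (m : ℕ) (Z V : AdjoinRoot (cyclotomic (2 ^ (a + 1) * p) ℤ)),
      Z * AdjoinRoot.lift (algebraMap ℤ _) (AdjoinRoot.root (cyclotomic (2 ^ (a + 1) * p) ℤ) ^ e)
        (eval₂_root_pow_cyclotomic hp.pos (coprime_exp hp he hpe)) Z =
        (1 + AdjoinRoot.root (cyclotomic (2 ^ (a + 1) * p) ℤ) ^ 2 ^ a) ^ (2 * m) * V →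
      ∃ Z' : AdjoinRoot (cyclotomic (2 ^ (a + 1) * p) ℤ),
        Z' * AdjoinRoot.lift (algebraMap ℤ _) (AdjoinRoot.root (cyclotomic (2 ^ (a + 1) * p) ℤ) ^ e)
          (eval₂_root_pow_cyclotomic hp.pos (coprime_exp hp he hpe)) Z' =
        (-(-(AdjoinRoot.root (cyclotomic (2 ^ (a + 1) * p) ℤ)) ^ 2 ^ a)) ^ m * V := by
  intro m
  induction m with
  | zero =>
    intro Z V h
    exact ⟨Z, by rw [h, mul_zero, pow_zero, one_mul, pow_zero, one_mul]⟩
  | succ m ih =>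
    intro Z V h
    obtain ⟨Z₁, h₁⟩ := peelE hp hp2 he hpe m Z V h
    obtain ⟨Z', h'⟩ := ih Z₁ _ h₁
    exact ⟨Z', by rw [h', ← mul_assoc, ← pow_succ]⟩

/-! ## §4 The descent -/

/-- **THE DESCENT THROUGH A RESIDUE FIELD** (`e ≡ 1 (mod 2^{a+1})`, `e ≡ −1 (mod p)`; `k ⊇ 𝔽_p` a field with `s^{2^a} = −1`
and NO `x` with `x^{2^{a+1}} = −1`; `j` odd): no `n ≥ 1`, `Z, U ∈ Λ`, `c ∈ kˣ` with `π(U) = c²` satisfy `Z ρ̃(Z) = n² μ^{pj} U`.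
[cite: FeinGordonSmith1971, pp. 310–315] -/
theorem descentK (hp : p.Prime) (hp2 : p ≠ 2) (he : e % 2 ^ (a + 1) = 1) (hpe : (e + 1) % p = 0) {s : k}
    (hs : s ^ 2 ^ a = -1) (hk : ∀ x : k, x ^ 2 ^ (a + 1) ≠ -1) {j : ℕ} (hj : Odd j) :
    ∀ (n : ℕ), 0 < n → ∀ (Z U : AdjoinRoot (cyclotomic (2 ^ (a + 1) * p) ℤ)) (c : k), c ≠ 0 →
      AdjoinRoot.lift (Int.castRingHom k) s (eval₂_cyclotomic_of_pow_eq hp hp2 hs) U = c ^ 2 →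
      Z * AdjoinRoot.lift (algebraMap ℤ _) (AdjoinRoot.root (cyclotomic (2 ^ (a + 1) * p) ℤ) ^ e)
        (eval₂_root_pow_cyclotomic hp.pos (coprime_exp hp he hpe)) Z =
        (n : AdjoinRoot (cyclotomic (2 ^ (a + 1) * p) ℤ)) ^ 2 *
          (AdjoinRoot.root (cyclotomic (2 ^ (a + 1) * p) ℤ) ^ (p * j) * U) →
      False := by
  haveI := isDomain (a := a) hp.pos
  haveI : Fact p.Prime := ⟨hp⟩
  set μ := AdjoinRoot.root (cyclotomic (2 ^ (a + 1) * p) ℤ) with hμ_def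
  set ρ := AdjoinRoot.lift (algebraMap ℤ _) (μ ^ e)
    (eval₂_root_pow_cyclotomic hp.pos (coprime_exp hp he hpe)) with hρ_def
  set π := AdjoinRoot.lift (Int.castRingHom k) s (eval₂_cyclotomic_of_pow_eq hp hp2 hs) with hπ_def
  have hπρ : ∀ Z, π (ρ Z) = π Z := liftK_rhoE_eq hp hp2 he hpe hs
  have hω : (π (μ ^ (p * j))) ^ 2 ^ a = -1 := liftK_root_pow_pow hp hp2 hs hj
  set ε := ∏ j ∈ Finset.range (p - 1), ∑ m ∈ Finset.range (j + 1), (-μ ^ 2 ^ a) ^ m with hε_def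
  have hpε : ((p : ℕ) : AdjoinRoot (cyclotomic (2 ^ (a + 1) * p) ℤ)) = (1 + μ ^ 2 ^ a) ^ (p - 1) * ε :=
    prime_eq_pow_mul hp hp2
  have hπε : π ε ≠ 0 := liftK_eps_ne_zero hp hp2 hs
  have hπη : π (-(-μ ^ 2 ^ a)) = -1 := by rw [map_neg, hπ_def, liftK_eta hp hp2 hs]
  intro n
  induction n using Nat.strong_induction_on with
  | _ n ih =>
  intro hn Z U c hc hU hrel
  by_cases hpn : p ∣ n
  · obtain ⟨n', rfl⟩ := hpn
    have hn' : 0 < n' := Nat.pos_of_mul_pos_left hn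
    have hrel' : Z * ρ Z = (1 + μ ^ 2 ^ a) ^ (2 * (p - 1)) * (ε ^ 2 * ((n' : AdjoinRoot (cyclotomic (2 ^ (a + 1) * p) ℤ)) ^ 2 *
        (μ ^ (p * j) * U))) := by
      rw [hrel, Nat.cast_mul, hpε]; ring
    obtain ⟨Z', hZ'⟩ := peelE_iter hp hp2 he hpe (p - 1) Z _ hrel'
    obtain ⟨h2, hh2⟩ := hp.even_sub_one hp2
    refine ih n' (by have := hp.two_le; nlinarith) hn' Z' ((-(-μ ^ 2 ^ a)) ^ (p - 1) * ε ^ 2 * U)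
      ((-1) ^ h2 * π ε * c) (mul_ne_zero (mul_ne_zero (pow_ne_zero _ (neg_ne_zero.2 one_ne_zero)) hπε) hc) ?_ ?_
    · rw [map_mul, map_mul, map_pow, map_pow, hπη, hU, hh2]; ring
    · rw [hZ']; ring
  · have hnz : ((n : ℕ) : k) ≠ 0 := by
      rw [← map_natCast (algebraMap (ZMod p) k), _root_.map_ne_zero, Ne, ZMod.natCast_eq_zero_iff]
      exact hpn
    have h := congrArg π hrel
    rw [map_mul, hπρ, map_mul, map_mul, map_pow, map_natCast, hU] at h
    set x : k := π Z / ((n : k) * c) with hx_def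
    have hx2 : x ^ 2 = π (μ ^ (p * j)) := by
      rw [hx_def, div_pow, div_eq_iff (pow_ne_zero 2 (mul_ne_zero hnz hc))]
      linear_combination h
    have hx4 : x ^ 2 ^ (a + 1) = -1 := by rw [pow_succ', pow_mul, hx2, hω]
    exact hk x hx4

end Residue

end Summit.HodgeConjecture.CorCM.CyclotomicTwoPowerP.Residue

end
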